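import Mathlib
import Summits.Schanuel.Schanuel.Theses.RootDecomp1E
import Summits.Schanuel.Schanuel.Theorems.RootDecomp1EAnchorToolkit
import Summits.Schanuel.Schanuel.Theorems.RootDecomp1EEStableRung
import Summits.Schanuel.Schanuel.Theorems.RootDecomp1EDefectOneSplit

-- `Summit.Schanuel.Schanuel.…` is the mandated layout of this single-problem summit (CONVENTIONS §1).
set_option linter.dupNamespace false

/-!
# RootDecomp1E — lens 2, gen 9 «ModuleType» (part 1/2): the MODULE TYPE of the generated field and the
# exact refinement `PlainDefectOne ⟸ (rich layers) ∧ (poor layers)` of the live residual stmt-Schanuel-31410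

Port, for the census / prover seat (`--supports stmt-Schanuel-31410`), of §1–§5 of the lens-2 gen-9 node
`HOME/decomp-schanuel-lens-2/g9/ModuleType.lean` (ROUND 9 of `route-Schanuel-RootDecomp1E`, theorem round
unless the operator types the resplit).  For a tuple `z` put `F_z = ℚ(z, e^z)`.  `z` is MODULE-RICH
(`ModuleRich z`) if `F_z` carries, up to algebraic elements, a grid configuration in the domain of one of
the four PROVED clauses of Nesterenko–Philippon Ch. 14 Theorem 2.9 (t₀: `dℓ ≥ 2(d+ℓ)`; t₁: `dℓ ≥ d+2ℓ` and
the `xᵢ` algebraic over `F_z`; t₂: `dℓ > d+ℓ` and `xᵢ, yⱼ` algebraic over `F_z`; Brownawell–Waldschmidt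
`(2,2)` with one row of exponentials in `ℚ̄`), always with every `e^{xᵢyⱼ}` algebraic over `F_z` and `0 < d`;
MODULE-POOR otherwise.  The type is an invariant of `F_z^{alg}` (`moduleRich_of_span_le`), not of the
tuple or of its span (round 7's multiplication type `End(span z) ∩ ℚ̄` is a span invariant).
This part: the vocabulary, the layer predicates `RichDefectOneAt n` / `PoorDefectOneAt n` (= `S⁻` at a
rich / poor sub-minimal first failure of length `n`), the EXACT split
`DefectOneSchanuel ⟺ (∀ n, RichDefectOneAt n) ∧ (∀ n, PoorDefectOneAt n)` (first-failure induction +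
excluded middle, no transcendence input), the dictionary with round 7 (E-stable of length `≥ 3` ⟹ rich,
so `(∀ n, RichDefectOneAt n) ⟹ EStableDefectOne` (31409) and `PlainDefectOne` (31410) ⟹ `∀ n, PoorDefectOneAt n`),
and field invariance.  Part 2 (`RootDecomp1EModuleTypeEngines`): rich ⟹ `trdeg F_z ≥ 2` at every length,
the decided layers, and `PlainDefectOne`'s first open layer `n = 3` ≡ `PoorDefectOneAt 3`.
Sorry-free; axioms `propext`, `Classical.choice`, `Quot.sound`.
[cite: NesterenkoPhilippon2001, Ch. 14 Theorem 2.9] [cite: BakerTNT1975, Ch. 12 Theorems 12.1, 12.2]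
-/

noncomputable section

namespace Summit.Schanuel.Schanuel.Theorems.RootDecomp1EModuleType

open Complex IntermediateField
open Summit.Schanuel.Schanuel.Theses.RootDecomp1E (DefectOneSchanuel EStableDefectOne PlainDefectOne)
open Summit.Schanuel.Schanuel.Theorems.RootDecomp1EAnchor (isAlgebraic_of_mem_adjoin
  trdeg_adjoin_le_of_isAlgebraic mem_adjoin_of_mem_span exp_isAlgebraic_of_mem_span isAlgebraic_transfer)
open Summit.Schanuel.Schanuel.Theorems.RootDecomp1EEStableRung (defectOne_of_le_two one_beta_linearIndependent)

/-! ## §1 Vocabulary: the type of the exponential module -/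

/-- **MODULE-RICH**: `F_z = ℚ(z, e^z)` carries, up to algebraic elements, a grid configuration in the domain
of one of the four proved clauses of Theorem 2.9 — t₀ (`dℓ ≥ 2(d+ℓ)`, exponentials algebraic over `F_z`),
t₁ (`dℓ ≥ d + 2ℓ`, also the `xᵢ`), t₂ (`dℓ > d + ℓ`, also the `yⱼ`), or Brownawell–Waldschmidt `(2,2)`
(one row with exponentials in `ℚ̄`).  `0 < d` excludes the vacuous empty grid. -/
def ModuleRich {ι : Type*} (z : ι → ℂ) : Prop :=
  ∃ (d l : ℕ) (x : Fin d → ℂ) (y : Fin l → ℂ), 0 < d ∧ LinearIndependent ℚ x ∧ LinearIndependent ℚ y ∧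
    (∀ i j, IsAlgebraic ↥(IntermediateField.adjoin ℚ (Set.range z ∪ Set.range (Complex.exp ∘ z)))
      (Complex.exp (x i * y j))) ∧
    (2 * (l + d) ≤ d * l ∨
      (d + 2 * l ≤ d * l ∧ ∀ i, IsAlgebraic ↥(IntermediateField.adjoin ℚ (Set.range z ∪ Set.range (Complex.exp ∘ z))) (x i)) ∨
      (l + d < d * l ∧ (∀ i, IsAlgebraic ↥(IntermediateField.adjoin ℚ (Set.range z ∪ Set.range (Complex.exp ∘ z))) (x i)) ∧
        ∀ j, IsAlgebraic ↥(IntermediateField.adjoin ℚ (Set.range z ∪ Set.range (Complex.exp ∘ z))) (y j)) ∨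
      (d = 2 ∧ l = 2 ∧ (∀ i, IsAlgebraic ↥(IntermediateField.adjoin ℚ (Set.range z ∪ Set.range (Complex.exp ∘ z))) (x i)) ∧
        (∀ j, IsAlgebraic ↥(IntermediateField.adjoin ℚ (Set.range z ∪ Set.range (Complex.exp ∘ z))) (y j)) ∧
        ∃ i, ∀ j, IsAlgebraic ℚ (Complex.exp (x i * y j))))

/-- **SUB-MINIMAL DEFECT** (first-failure locality for `S⁻`, as in round 7): every strictly shorter ℚ-free
tuple inside `span_ℚ z` has Schanuel defect `≤ 1`. -/
def SubMinimalDefect (n : ℕ) (z : Fin n → ℂ) : Prop :=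
  ∀ (m : ℕ) (w : Fin m → ℂ), m < n → LinearIndependent ℚ w →
    (∀ j, w j ∈ Submodule.span ℚ (Set.range z)) →
    (m : Cardinal) ≤ Algebra.trdeg ℚ ↥(IntermediateField.adjoin ℚ
      (Set.range w ∪ Set.range (Complex.exp ∘ w))) + 1

/-! ## §2 The layer predicates: `S⁻` at a rich / poor sub-minimal first failure of length `n` -/

/-- `S⁻` at every MODULE-RICH, SUB-MINIMAL ℚ-free tuple of length `n`. -/
def RichDefectOneAt (n : ℕ) : Prop :=
  ∀ (z : Fin n → ℂ), LinearIndependent ℚ z → ModuleRich z → SubMinimalDefect n z →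
    (n : Cardinal) ≤ Algebra.trdeg ℚ ↥(IntermediateField.adjoin ℚ (Set.range z ∪ Set.range (Complex.exp ∘ z))) + 1

/-- `S⁻` at every MODULE-POOR, SUB-MINIMAL ℚ-free tuple of length `n` (the layers of the round-9 residual). -/
def PoorDefectOneAt (n : ℕ) : Prop :=
  ∀ (z : Fin n → ℂ), LinearIndependent ℚ z → ¬ ModuleRich z → SubMinimalDefect n z →
    (n : Cardinal) ≤ Algebra.trdeg ℚ ↥(IntermediateField.adjoin ℚ (Set.range z ∪ Set.range (Complex.exp ∘ z))) + 1

/-! ## §3 The split is EXACT: `S⁻ ⟺ (∀ n, Rich n) ∧ (∀ n, Poor n)` -/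

/-- The glue in its natural order: strong induction on the length discharges sub-minimality below the first
failure, then excluded middle on the module type.  No transcendence input. -/
theorem defectOne_of_richAt_of_poorAt (hR : ∀ n, RichDefectOneAt n) (hP : ∀ n, PoorDefectOneAt n) :
    DefectOneSchanuel := by
  intro n
  induction n using Nat.strong_induction_on with
  | _ n ih =>
    intro z hz
    have hsub : SubMinimalDefect n z := fun m w hm hw _ => ih m hm w hw
    by_cases hst : ModuleRich z
    · exact hR n z hz hst hsub
    · exact hP n z hz hst hsub

/-- S⁻ (DefectOneSchanuel) implies the rich piece at every length. -/
theorem richAt_of_defectOne (hD : DefectOneSchanuel) (n : ℕ) : RichDefectOneAt n := fun z hz _ _ => hD n z hz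

/-- S⁻ (DefectOneSchanuel) implies the poor piece at every length. -/
theorem poorAt_of_defectOne (hD : DefectOneSchanuel) (n : ℕ) : PoorDefectOneAt n := fun z hz _ _ => hD n z hz

/-- **EXACTNESS of the round-9 cut.** -/
theorem defectOne_iff_richAt_poorAt :
    DefectOneSchanuel ↔ (∀ n, RichDefectOneAt n) ∧ (∀ n, PoorDefectOneAt n) :=
  ⟨fun h => ⟨richAt_of_defectOne h, poorAt_of_defectOne h⟩,
    fun h => defectOne_of_richAt_of_poorAt h.1 h.2⟩

/-! ## §4 Dictionary with round 7: E-stable ⟹ module-rich (`n ≥ 3`); the residual SHRINKS -/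

/-- An E-STABLE span of length `n ≥ 3` is MODULE-RICH: `x = (1, β)`, `y = z` is a `(2, n)` t₂-grid in
`span_ℚ z ⊆ Λ(F_z)` (`n + 2 < 2n`). -/
theorem moduleRich_of_eStable {n : ℕ} (hn : 3 ≤ n) {z : Fin n → ℂ} (hz : LinearIndependent ℚ z)
    (hE : ∃ β : ℂ, IsAlgebraic ℚ β ∧ β ∉ Set.range (algebraMap ℚ ℂ) ∧
      ∀ i, β * z i ∈ Submodule.span ℚ (Set.range z)) : ModuleRich z := by
  obtain ⟨β, hβ, hβq, hβV⟩ := hE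
  unfold ModuleRich
  refine ⟨2, n, ![(1 : ℂ), β], z, by norm_num, one_beta_linearIndependent hβq, hz, ?_,
    Or.inr (Or.inr (Or.inl ⟨by omega, ?_, ?_⟩))⟩
  · intro i j
    apply exp_isAlgebraic_of_mem_span
    fin_cases i
    · simpa using (Submodule.subset_span ⟨j, rfl⟩ : z j ∈ Submodule.span ℚ (Set.range z))
    · simpa using hβV j
  · intro i
    fin_cases i
    · simpa using (isAlgebraic_one : IsAlgebraic ℚ (1 : ℂ)).tower_top
        (L := ↥(IntermediateField.adjoin ℚ (Set.range z ∪ Set.range (Complex.exp ∘ z))))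
    · simpa using hβ.tower_top
        (L := ↥(IntermediateField.adjoin ℚ (Set.range z ∪ Set.range (Complex.exp ∘ z))))
  · intro j
    exact isAlgebraic_of_mem_adjoin (mem_adjoin_of_mem_span (Submodule.subset_span ⟨j, rfl⟩))

/-- Contrapositive: a MODULE-POOR ℚ-free tuple of length `≥ 3` is PLAIN (only rational algebraic multipliers). -/
theorem plain_of_not_moduleRich {n : ℕ} (hn : 3 ≤ n) {z : Fin n → ℂ} (hz : LinearIndependent ℚ z)
    (hpoor : ¬ ModuleRich z) :
    ∀ β : ℂ, IsAlgebraic ℚ β → (∀ i, β * z i ∈ Submodule.span ℚ (Set.range z)) →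
      β ∈ Set.range (algebraMap ℚ ℂ) := by
  intro β hβ hβV
  by_contra hq
  exact hpoor (moduleRich_of_eStable hn hz ⟨β, hβ, hq, hβV⟩)

/-- DICTIONARY 1: the rich layers CONTAIN round 7's E-stable piece (stmt-Schanuel-31409). -/
theorem eStableDefectOne_of_richAt (hR : ∀ n, RichDefectOneAt n) : EStableDefectOne := by
  intro n z hz hE hsub
  rcases Nat.lt_or_ge n 3 with h3 | h3
  · exact defectOne_of_le_two n (by omega) z hz
  · exact hR n z hz (moduleRich_of_eStable h3 hz hE) hsub

/-- DICTIONARY 2: round 7's residual `PlainDefectOne` (stmt-Schanuel-31410) IMPLIES every poor layer —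
the round-9 residual is formally WEAKER. -/
theorem poorAt_of_plainDefectOne (hP : PlainDefectOne) (n : ℕ) : PoorDefectOneAt n := by
  intro z hz hpoor hsub
  rcases Nat.lt_or_ge n 3 with h3 | h3
  · exact defectOne_of_le_two n (by omega) z hz
  · exact hP n z hz (plain_of_not_moduleRich h3 hz hpoor) hsub

/-- Conversely `PlainDefectOne` follows from ALL rich and poor layers (through `S⁻`). -/
theorem plainDefectOne_of_richAt_of_poorAt (hR : ∀ n, RichDefectOneAt n) (hP : ∀ n, PoorDefectOneAt n) :
    PlainDefectOne :=
  fun n z hz _ _ => defectOne_of_richAt_of_poorAt hR hP n z hz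

/-- Round 7's split REFINES INTO round 9's: `ES ∧ Pl ⟹ (∀ Rich) ∧ (∀ Poor)`. -/
theorem richAt_poorAt_of_eStable_plain (hE : EStableDefectOne) (hP : PlainDefectOne) :
    (∀ n, RichDefectOneAt n) ∧ (∀ n, PoorDefectOneAt n) :=
  defectOne_iff_richAt_poorAt.mp
    (Summit.Schanuel.Schanuel.Theorems.RootDecomp1EDefectOneSplit.defectOne_of_eStable_of_plain hE hP)

/-! ## §5 Field invariance: the type depends on `z` only through `F_z^{alg}` -/

/-- Module-richness passes from `z` to any tuple `w` whose span contains `z` (then `F_z ⊆ F_w^{alg}`); in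
particular tuples with equal spans — and all generator tuples of algebraically equivalent fields — have the
same module type.  (Round 7's multiplication type is an invariant of the SPAN only.) -/
theorem moduleRich_of_span_le {ι κ : Type*} {z : ι → ℂ} {w : κ → ℂ}
    (h : ∀ k, z k ∈ Submodule.span ℚ (Set.range w)) (hz : ModuleRich z) : ModuleRich w := by
  unfold ModuleRich at hz ⊢
  obtain ⟨d, l, x, y, hd, hx, hy, heF, hrest⟩ := hz
  refine ⟨d, l, x, y, hd, hx, hy, fun i j => isAlgebraic_transfer h (heF i j), ?_⟩
  rcases hrest with h0 | ⟨h1, hxF⟩ | ⟨h2, hxF, hyF⟩ | ⟨hd2, hl2, hxF, hyF, hi⟩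
  · exact Or.inl h0
  · exact Or.inr (Or.inl ⟨h1, fun i => isAlgebraic_transfer h (hxF i)⟩)
  · exact Or.inr (Or.inr (Or.inl ⟨h2, fun i => isAlgebraic_transfer h (hxF i),
      fun j => isAlgebraic_transfer h (hyF j)⟩))
  · exact Or.inr (Or.inr (Or.inr ⟨hd2, hl2, fun i => isAlgebraic_transfer h (hxF i),
      fun j => isAlgebraic_transfer h (hyF j), hi⟩))

end Summit.Schanuel.Schanuel.Theorems.RootDecomp1EModuleType

end
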